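import Summits.BirchSwinnertonDyer.BirchSwinnertonDyer.Theorems.GenusKolyvaginAtTwoGenusPrimitiveSupplyAtTwoTwistingPrimeKolyvagin
import Literature.NumberTheory.EllipticCurves.TateModuleGaloisTransportProofs
import Literature.NumberTheory.EllipticCurves.QuadraticTwistSelmerPInfty
import HarnessLib

/-!
# Route `GenusKolyvaginAtTwo`, crux #2 `GenusPrimitiveSupplyAtTwo` (stmt-BirchSwinnertonDyer-22136):
# Kolyvagin twisting primes for the PAIR `(E, E^{(d)})` — `H¹(ℚ, E^{(d)}[2]) = H¹(ℚ, E[2])`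

Width seat `bsd-line-gk2-p4` g7, cell `bsd-f1-sign2`; helper (`--supports stmt-BirchSwinnertonDyer-22136`),
fifth file of the twisting-prime series (after `…TwistingPrimeKolyvagin`). THEOREMS ONLY: no definition,
no named fact, no `sorry`; no item is closed; BSD is not proved by any of this.

WHY. The LEVEL LAW of the lead's line (`Lines/genus-supply-depthlaw.md` §3) reads the operative case of
U on WALL row 1 as «a Kolyvagin prime `ℓ` whose GENUS PAIR `(E^{(ℓ*)}, E^{(ℓ*d_K)})` is `2`-Selmer-
minimal» + EXACT-INDEX₂. By Mazur–Rubin Cor. 3.4 (i) (tree fact `cor34i_singleton_rat`) applied to `E`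
and to the twin `E^{(d_K)}` at `ℓ`, the Selmer half of that supply is: a Kolyvagin prime `ℓ` at which
NEITHER `Sel₂(E)` NOR `Sel₂(E^{(d_K)})` is strict. `…TwistingPrimeKolyvagin` proves this for two classes
of `H¹(ℚ, E[2])`; this file moves the twin's class into `H¹(ℚ, E[2])`:

* §11 `exists_h1Map_of_equivariant_addEquiv` — for curves `X', X` over a field `K` and a
  `Γ_K`-equivariant `ψ : X'[n] ≃+ X[n]`: an INJECTIVE `Ψ : H¹(K, X'[n]) → H¹(K, X[n])` with
  `[Ψ x, ρ] = ψ [x, ρ]` carrying strict local kernels to strict local kernels (gk2-p2's `coeffH1Map`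
  for two curves; inverse from `ψ⁻¹` on cocycles).
* §12 `exists_equivariant_addEquiv_geomTorsion_two_of_twist` — for `2 ≠ 0` in `K`, `d ≠ 0` and ANY
  model `Wd` (`C • W^{(d)} = Wd`): a `Γ_K`-equivariant `Wd[2] ≃+ W[2]` (*AEC* X.5 Cor. 5.4 signed
  isomorphism, tree `exists_addEquiv_geomPoints_quadraticTwist_sign`, + `twistPointsIso`; the sign dies
  on `2`-torsion — Mazur–Rubin Remark 2.4).
* §13 `exists_kolyvaginPrime_not_mem_torsionLocalKer_twin` / `…_not_selmerGroup_le_strictLocalKer_twin`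
  — `Δ(W) < 0`, `ρ̄_{W,2}` onto, `K` imaginary quadratic, `Wd` an elliptic model of `W^{(d)}`, non-zero
  classes (resp. `#Sel₂ ≠ 1` for both curves), `m`, `N`, `B₀`: a prime `ℓ ∉ B₀`, `m ∣ ℓ + 1`,
  `IsKolyvaginPrime N W K 2 ℓ` (Gross, depth one), with both classes (resp. both Selmer groups) NOT
  strict at `ℓ` — unconditional. What remains of the genus-pair supply is PRINT (cor34i, twice).

References: [MazurRubin2010] Remark 2.4, Prop. 3.3, Cor. 3.4 (i), Lemma 3.5; [SilvermanAEC2009] X.5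
Cor. 5.4; [GrossLMS1991] §3, §9.
-/

set_option linter.dupNamespace false -- tree convention: `Summit.BirchSwinnertonDyer.BirchSwinnertonDyer.Theorems` (summit = sub-problem)
set_option autoImplicit false

noncomputable section

open scoped Classical Pointwise

namespace Summit.BirchSwinnertonDyer.BirchSwinnertonDyer.Theorems.GenusKolyTwistingPrime

open WeierstrassCurve NumberField IsDedekindDomain Field
open Literature.NumberTheory.GaloisRepresentations Literature.NumberTheory.EllipticCurves
open Literature.NumberTheory

/-! ## §11 `H¹(K, E'[n]) → H¹(K, E[n])` along a `Γ_K`-equivariant isomorphism of the coefficients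
(two curves; after gk2-p2's `coeffH1Map` for endomorphisms) -/

section CoeffTwo

universe u

variable {K : Type u} [Field K] (X' X : WeierstrassCurve K) (n : ℤ)

/-- **`H¹(id, ψ)` for a `Γ_K`-equivariant isomorphism `ψ : E'[n] ≃ E[n]` of the coefficient modules of
two curves**: an INJECTIVE additive map `Ψ : H¹(K, E'[n]) → H¹(K, E[n])` (`[f] ↦ [ψ ∘ f]`, with inverse
`[g] ↦ [ψ⁻¹ ∘ g]`) which carries every strict local kernel `ker (H¹(K, E'[n]) → H¹(K_v, E'[n]))` into
the corresponding one for `E` (a local coboundary `g ↦ gQ − Q`, `Q = ι(P)`, goes to that of `ι(ψ P)`;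
needs `E'(K̄)[n] → E'(K̄_v)[n]` onto), and satisfies `[Ψ x, ρ] = ψ [x, ρ]`. Mathlib `ContinuousCohomology.map` along the compatible pair
`(id, ψ)`. [folklore] -/
theorem exists_h1Map_of_equivariant_addEquiv (ψ : geomTorsion X' n ≃+ geomTorsion X n)
    (hψ : ∀ (g : absoluteGaloisGroup K) (t : geomTorsion X' n), ψ (g • t) = g • ψ t) :
    ∃ Ψ : galH1Torsion X' n →+ galH1Torsion X n, Function.Injective Ψ ∧
      (∀ (x : galH1Torsion X' n) {ρ : absoluteGaloisGroup K}, ρ ∈ torsionFixing X n →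
        ρ ∈ torsionFixing X' n → h1Eval X n (Ψ x) ρ = ψ (h1Eval X' n x ρ)) ∧
      ∀ (E : Type u) [Field E] [Algebra K E], Function.Surjective (torsionPointsMap X' E n) →
        ∀ x ∈ X'.torsionLocalKer E n, Ψ x ∈ X.torsionLocalKer E n := by
  have hψ' : ∀ (g : absoluteGaloisGroup K) (t : geomTorsion X n), ψ.symm (g • t) = g • ψ.symm t :=
    fun g t ↦ ψ.injective (by rw [hψ, ψ.apply_symm_apply, ψ.apply_symm_apply])
  set F := resHomOfEquivariant (ContinuousMonoidHom.id (absoluteGaloisGroup K))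
    (ψ : geomTorsion X' n →+ geomTorsion X n) (fun g t ↦ hψ g t) with hF
  set F' := resHomOfEquivariant (ContinuousMonoidHom.id (absoluteGaloisGroup K))
    (ψ.symm : geomTorsion X n →+ geomTorsion X' n) (fun g t ↦ hψ' g t) with hF'
  set Ψ : galH1Torsion X' n →+ galH1Torsion X n :=
    (ContinuousCohomology.map (ContinuousMonoidHom.id (absoluteGaloisGroup K)) F 1
      ).hom.toLinearMap.toAddMonoidHom with hΨ
  set Ψ' : galH1Torsion X n →+ galH1Torsion X' n :=
    (ContinuousCohomology.map (ContinuousMonoidHom.id (absoluteGaloisGroup K)) F' 1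
      ).hom.toLinearMap.toAddMonoidHom with hΨ'
  have hΨclass : ∀ f, Ψ (oneCocycleClass _ f) =
      oneCocycleClass _ (contOneCocycles.pullback (ContinuousMonoidHom.id (absoluteGaloisGroup K))
        F f) := fun f ↦ by
    rw [hΨ, LinearMap.toAddMonoidHom_coe, ContinuousLinearMap.coe_coe, map_oneCocycleClass]
  have hΨ'class : ∀ f, Ψ' (oneCocycleClass _ f) =
      oneCocycleClass _ (contOneCocycles.pullback (ContinuousMonoidHom.id (absoluteGaloisGroup K))
        F' f) := fun f ↦ by
    rw [hΨ', LinearMap.toAddMonoidHom_coe, ContinuousLinearMap.coe_coe, map_oneCocycleClass]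
  -- `Ψ' ∘ Ψ = id` (on cocycles: `ψ⁻¹ ∘ ψ ∘ f = f`), so `Ψ` is injective
  have hleft : ∀ x, Ψ' (Ψ x) = x := by
    intro x
    obtain ⟨f, rfl⟩ :=
      oneCocycleClass_surjective (discreteTopRep (absoluteGaloisGroup K) (geomTorsion X' n)) x
    rw [hΨclass, hΨ'class]
    congr 1
    apply Subtype.ext
    apply ContinuousMap.ext
    intro g
    rw [contOneCocycles.pullback_apply, contOneCocycles.pullback_apply]
    exact (show ψ.symm (ψ (f.1 g)) = f.1 g from ψ.symm_apply_apply _)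
  refine ⟨Ψ, fun a b hab ↦ by rw [← hleft a, ← hleft b, hab], fun x ρ hρ hρ' ↦ ?_,
    fun E _ _ hsurj x hx ↦ ?_⟩
  · -- evaluation: `[Ψ x, ρ] = ψ [x, ρ]`
    conv_lhs => rw [← oneCocycleClass_reprCocycle X' n x]
    rw [hΨclass, h1Eval_oneCocycleClass _ n _ hρ, contOneCocycles.pullback_apply]
    rfl
  · -- strict local kernels are preserved
    obtain ⟨f, rfl⟩ :=
      oneCocycleClass_surjective (discreteTopRep (absoluteGaloisGroup K) (geomTorsion X' n)) x
    rw [hΨclass]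
    change _ = 0 at hx
    change _ = 0
    rw [LinearMap.toAddMonoidHom_coe, ContinuousLinearMap.coe_coe, map_oneCocycleClass,
      oneCocycleClass_eq_zero_iff] at hx ⊢
    obtain ⟨Q, hQ⟩ := hx
    obtain ⟨P, rfl⟩ := hsurj Q
    refine ⟨torsionPointsMap X E n (ψ P), fun g ↦ ?_⟩
    have hg := hQ g
    rw [contOneCocycles.pullback_apply, discreteTopRep_ρ_apply] at hg ⊢
    have hg' : torsionPointsMap X' E n (f.1 (resGal (K := K) E g)) =
        torsionPointsMap X' E n (resGal (K := K) E g • P - P) := by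
      rw [map_sub, torsionPointsMap_smul]; exact hg
    have hinj := torsionPointsMap_injective X' E n hg'
    change torsionPointsMap X E n (ψ (f.1 (resGal (K := K) E g))) = _
    rw [hinj, map_sub, hψ, map_sub, torsionPointsMap_smul]

end CoeffTwo

/-! ## §12 The `2`-torsion of a quadratic twist is the `2`-torsion of the curve, `Γ`-equivariantly -/

section TwistTwo

universe u

variable {K : Type u} [Field K] [NeZero (2 : K)] (W : WeierstrassCurve K)

/-- **`E^{(d)}[2] ≅ E[2]` as `Γ_K`-modules** for ANY model `Wd` of the quadratic twist
(`C • W^{(d)} = Wd`): the signed isomorphism `E^{(d)}(K̄) ≃+ E(K̄)` of *AEC* X.5 Cor. 5.4 (tree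
`exists_addEquiv_geomPoints_quadraticTwist_sign`: `f(σP) = ±σf(P)` according as `σ√d = ±√d`),
composed with the change of variables (`twistPointsIso`), is `Γ_K`-equivariant on `2`-torsion, where
`−Q = Q` (Mazur–Rubin 2010, Remark 2.4: `H¹(K, E[2]) = H¹(K, E^F[2])`).
[cite: SilvermanAEC2009, X.5 Cor. 5.4] [cite: MazurRubin2010, Remark 2.4] -/
theorem exists_equivariant_addEquiv_geomTorsion_two_of_twist {d : K} (hd : d ≠ 0)
    {Wd : WeierstrassCurve K} {C : VariableChange K} (hWd : C • W.quadraticTwist d = Wd) :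
    ∃ ψ : geomTorsion Wd (2 : ℤ) ≃+ geomTorsion W (2 : ℤ),
      ∀ (g : absoluteGaloisGroup K) (t : geomTorsion Wd (2 : ℤ)), ψ (g • t) = g • ψ t := by
  obtain ⟨f, hfpos, hfneg⟩ := W.exists_addEquiv_geomPoints_quadraticTwist_sign hd
  set e : geomPoints Wd ≃+ geomPoints W := (twistPointsIso hWd).symm.trans f with he
  -- `e` is equivariant up to sign
  have htw : ∀ (g : absoluteGaloisGroup K) (Q : geomPoints Wd),
      (twistPointsIso hWd).symm (g • Q) = g • (twistPointsIso hWd).symm Q := fun g Q ↦ by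
    apply (twistPointsIso hWd).injective
    rw [AddEquiv.apply_symm_apply, twistPointsIso_smul, AddEquiv.apply_symm_apply]
  have hsign : ∀ (g : absoluteGaloisGroup K) (Q : geomPoints Wd),
      e (g • Q) = g • e Q ∨ e (g • Q) = -(g • e Q) := fun g Q ↦ by
    simp only [he, AddEquiv.trans_apply, htw]
    rcases map_geomSqrt (absoluteGaloisGroup.toAlgEquiv K g) d with h | h
    · exact Or.inl (hfpos g h _)
    · exact Or.inr (hfneg g h _)
  have hmem : ∀ Q : geomPoints Wd, Q ∈ geomTorsion Wd (2 : ℤ) → e Q ∈ geomTorsion W (2 : ℤ) :=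
    fun Q hQ ↦ by
    rw [mem_geomTorsion_iff, ← map_zsmul, (mem_geomTorsion_iff Wd (2 : ℤ) Q).mp hQ, map_zero]
  have hmem' : ∀ P : geomPoints W, P ∈ geomTorsion W (2 : ℤ) → e.symm P ∈ geomTorsion Wd (2 : ℤ) :=
    fun P hP ↦ by
    rw [mem_geomTorsion_iff, ← map_zsmul, (mem_geomTorsion_iff W (2 : ℤ) P).mp hP, map_zero]
  let ψ : geomTorsion Wd (2 : ℤ) ≃+ geomTorsion W (2 : ℤ) :=
    { toFun := fun t ↦ ⟨e t.1, hmem t.1 t.2⟩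
      invFun := fun s ↦ ⟨e.symm s.1, hmem' s.1 s.2⟩
      left_inv := fun t ↦ Subtype.ext (e.symm_apply_apply t.1)
      right_inv := fun s ↦ Subtype.ext (e.apply_symm_apply s.1)
      map_add' := fun a b ↦ Subtype.ext (by simp only [AddSubgroup.coe_add, map_add]) }
  refine ⟨ψ, fun g t ↦ Subtype.ext ?_⟩
  change e ((g • t : geomTorsion Wd (2 : ℤ)) : geomPoints Wd) = ((g • (ψ t) : geomTorsion W (2 : ℤ)) : geomPoints W)
  rw [Literature.NumberTheory.EllipticCurves.AddSubgroup.torsionBy.coe_smul,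
    Literature.NumberTheory.EllipticCurves.AddSubgroup.torsionBy.coe_smul]
  change e (g • (t : geomPoints Wd)) = g • e (t : geomPoints Wd)
  rcases hsign g t with h | h
  · exact h
  · rw [h]
    -- `-(g • e t) = g • e t` on `2`-torsion
    have h2 : (2 : ℤ) • (g • e (t : geomPoints Wd)) = 0 := by
      have hcomm := map_zsmul (DistribSMul.toAddMonoidHom (geomPoints W) g) (2 : ℤ)
        (e (t : geomPoints Wd))
      change g • ((2 : ℤ) • e (t : geomPoints Wd)) = (2 : ℤ) • (g • e (t : geomPoints Wd)) at hcomm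
      rw [← hcomm, ← map_zsmul e, (mem_geomTorsion_iff Wd (2 : ℤ) _).mp t.2, map_zero, smul_zero]
    rw [two_zsmul] at h2
    exact neg_eq_of_add_eq_zero_left h2

end TwistTwo

/-! ## §13 Kolyvagin twisting primes for a class of `E` AND a class of a twist `E^{(d)}` -/

section Twin

variable (W : WeierstrassCurve ℚ) [W.IsElliptic] {K : Type} [Field K] [NumberField K]

/-- **KOLYVAGIN TWISTING PRIMES FOR THE PAIR `(E, E^{(d)})`.** `W/ℚ` elliptic with `Δ(W) < 0` and
`ρ̄_{W,2}` onto, `K` imaginary quadratic, `Wd` any elliptic model of a quadratic twist `W^{(d)}`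
(`C • W^{(d)} = Wd`, `d ≠ 0`; e.g. the twin `E^{(d_K)}`), `0 ≠ c ∈ H¹(ℚ, E[2])`, `0 ≠ c' ∈ H¹(ℚ, E^{(d)}[2])`,
`m ≥ 1`, `N ≥ 1`, `B₀` finite. Then there is a prime `ℓ ∉ B₀`, `m ∣ ℓ + 1`, which is a KOLYVAGIN PRIME for
`(E, K, 2)` in Gross's sense (depth one) and at which BOTH `c_ℓ ≠ 0` in `H¹(ℚ_ℓ, E[2])` and `c'_ℓ ≠ 0` in
`H¹(ℚ_ℓ, E^{(d)}[2])`: transport `c'` to `H¹(ℚ, E[2])` along `E^{(d)}[2] ≅ E[2]` (§§11–12) and apply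
`exists_kolyvaginPrime_not_mem_torsionLocalKer_pair`. The Čebotarev half of «the genus pair
`(E^{(ℓ*)}, E^{(ℓ*d_K)})` is `2`-Selmer-minimal» in the LEVEL LAW (`Lines/genus-supply-depthlaw.md` §3;
the Selmer-rank half is Mazur–Rubin Cor. 3.4 (i) applied to `E` and to `E^{(d_K)}` at `ℓ`).
[cite: MazurRubin2010, Prop. 3.3, Cor. 3.4 (i), Lemma 3.5] [cite: GrossLMS1991, §3 (3.1)–(3.2), §9 Prop. 9.6] -/
theorem exists_kolyvaginPrime_not_mem_torsionLocalKer_twin (hsurj : W.HasSurjectiveModNGaloisRep 2)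
    (hΔ : W.Δ < 0) (hK : IsImaginaryQuadratic K) {d : ℚ} (hd : d ≠ 0) {Wd : WeierstrassCurve ℚ}
    [Wd.IsElliptic] {C : VariableChange ℚ} (hWd : C • W.quadraticTwist d = Wd)
    {c : galH1Torsion W (2 : ℤ)} (hc : c ≠ 0) {c' : galH1Torsion Wd (2 : ℤ)} (hc' : c' ≠ 0)
    {m : ℕ} (hm : m ≠ 0) (N : ℕ) [NeZero N] (B₀ : Finset ℕ) :
    ∃ ℓ : ℕ, ∃ _ : Fact ℓ.Prime, ℓ ∉ B₀ ∧ m ∣ ℓ + 1 ∧ IsKolyvaginPrime N W K 2 ℓ ∧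
      c ∉ W.torsionLocalKer ℚ_[ℓ] (2 : ℤ) ∧ c' ∉ Wd.torsionLocalKer ℚ_[ℓ] (2 : ℤ) := by
  obtain ⟨ψ, hψ⟩ := exists_equivariant_addEquiv_geomTorsion_two_of_twist W hd hWd
  obtain ⟨Ψ, hinj, -, hker⟩ := exists_h1Map_of_equivariant_addEquiv Wd W (2 : ℤ) ψ hψ
  have hy : Ψ c' ≠ 0 := fun h ↦ hc' (hinj (by rw [h, map_zero]))
  obtain ⟨ℓ, hℓF, hℓB₀, hmdvd, hKoly, hcℓ, hyℓ⟩ :=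
    exists_kolyvaginPrime_not_mem_torsionLocalKer_pair W hsurj hΔ hK hc hy hm N B₀
  refine ⟨ℓ, hℓF, hℓB₀, hmdvd, hKoly, hcℓ, fun h' ↦ hyℓ ?_⟩
  have hsurj' : Function.Surjective (torsionPointsMap Wd ℚ_[ℓ] (2 : ℤ)) :=
    (torsionPointsMap_bijective Wd ℚ_[ℓ] (n := 2) two_ne_zero).2
  exact hker ℚ_[ℓ] hsurj' c' h'

/-- **The same in Mazur–Rubin's currency**: if `#Sel₂(W) ≠ 1` and `#Sel₂(Wd) ≠ 1` (e.g. `#Sel₂(E) = 4` on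
WALL row 1 and a `2`-Selmer-minimal twin, `#Sel₂ = 2`), then beyond every finite set there is a Kolyvagin
prime `ℓ` for `(E, K, 2)` with `m ∣ ℓ + 1` at which NEITHER `Sel₂(W)` NOR `Sel₂(Wd)` is strict
(`¬ Sel₂ ≤ ker loc_ℓ`, Mazur–Rubin's `V_{{ℓ}} ≠ 0` for both curves). Unconditional.
[cite: MazurRubin2010, Prop. 3.3, Cor. 3.4 (i), Lemma 3.5] [cite: GrossLMS1991, §9 Prop. 9.6] -/
theorem exists_kolyvaginPrime_not_selmerGroup_le_strictLocalKer_twin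
    (hsurj : W.HasSurjectiveModNGaloisRep 2) (hΔ : W.Δ < 0) (hK : IsImaginaryQuadratic K) {d : ℚ}
    (hd : d ≠ 0) {Wd : WeierstrassCurve ℚ} [Wd.IsElliptic] {C : VariableChange ℚ}
    (hWd : C • W.quadraticTwist d = Wd) (hS : Nat.card (W.selmerGroup 2) ≠ 1)
    (hS' : Nat.card (Wd.selmerGroup 2) ≠ 1) {m : ℕ} (hm : m ≠ 0) (N : ℕ) [NeZero N] (B₀ : Finset ℕ) :
    ∃ ℓ : ℕ, ∃ _ : Fact ℓ.Prime, ℓ ∉ B₀ ∧ m ∣ ℓ + 1 ∧ IsKolyvaginPrime N W K 2 ℓ ∧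
      ¬ W.selmerGroup 2 ≤ MazurRubin2010.strictLocalKer W ℚ_[ℓ] 2 ∧
      ¬ Wd.selmerGroup 2 ≤ MazurRubin2010.strictLocalKer Wd ℚ_[ℓ] 2 := by
  have hne : ∀ (V : WeierstrassCurve ℚ), Nat.card (V.selmerGroup 2) ≠ 1 →
      ∃ c ∈ V.selmerGroup 2, c ≠ 0 := fun V hV ↦ by
    by_contra h
    push Not at h
    exact hV (by rw [(AddSubgroup.eq_bot_iff_forall _).mpr h, AddSubgroup.card_bot])
  obtain ⟨c, hcS, hc0⟩ := hne W hS
  obtain ⟨c', hcS', hc0'⟩ := hne Wd hS'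
  obtain ⟨ℓ, hℓF, hℓB₀, hmdvd, hKoly, hcℓ, hcℓ'⟩ :=
    exists_kolyvaginPrime_not_mem_torsionLocalKer_twin W hsurj hΔ hK hd hWd hc0 hc0' hm N B₀
  exact ⟨ℓ, hℓF, hℓB₀, hmdvd, hKoly, fun hle ↦ hcℓ (hle hcS), fun hle ↦ hcℓ' (hle hcS')⟩

end Twin

end Summit.BirchSwinnertonDyer.BirchSwinnertonDyer.Theorems.GenusKolyTwistingPrime

end
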